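import Summits.QuantumFields.BalabanUV.Beta.FP.TowerDoorUniformDataColumn
import Summits.QuantumFields.BalabanUV.Beta.NVertexColumnK1RowSym
import Summits.QuantumFields.BalabanUV.Beta.GAN24.SymFaceDataVHNull

/-!
# `BalabanUV.Beta.FP.TowerDoorUniformDataSym` — binder row D1 ∕ (C1), the L-DOOR's missing letter `hΘ`, FORM-LEVEL AND KERNEL-JUNCTION PIECES AT THE (0.4) CHART:
# **THE (0.4)-SYMMETRISED COMPOSITE CORRECTOR `Ψ̂ˢ_m` FIXES EVERY 1-FORM SUPPORTED ON THE BONDS CROSSING THE `L^m`-FACES**, hence the L-chart's field–multiplier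
# column summed over its sources is the comb representative of the constant connection — PART 50 `TowerDoorUniformDataCorrector` §3–§4 and PART 51
# `TowerDoorUniformDataColumn` §1∕§3 with the ONE chart token changed (`corrPsi ↦ corrPsiSym`, `AN R j ↦ ANs R Ψ̂ˢ j`)
# (β-function cell `pub-balaban`, BINDER-OWNERS row D1 ∕ (C1) OWNER «beta-an2» gen 94, L-door wave 2; director-ym g23 [DIRYM-G23-INBOX-3] «door def + four letters … ONE wave»).

WHY (located).  The L door (PART 87's record door re-pinned at `A := scaleK σₙ σₙ (ANs ρ_c Ψ̂ˢ (n+1))`, gen-94 `TowerDoorRecordDefsGS ∕ PairingGS ∕ LettersGS`) has every letter of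
PART 88 but `hΘ`: PART 84∕86 (`TowerDoorGaugeLatticeSumG.hasSum_lamZG_sources`, `TowerDoorGaugeFunctionalG.tsum_tsum_translate_mul_lamZG_eq_zero`) are chart-GENERIC and ask of the
chart `A` exactly two facts — summable sublattice columns (hAs) and the FACE READ-OUT (hface) `quo L x = quo L (x + e_κ) ⟹ Σ'_z A x (L•z) (inl κ) (inr μ) = 0`.  At the rooted chart
`AN` the read-out is PART 51 `tsum_AN_inl_inr_sources_eq` over PART 50 `corrPsi_axProjBmAt_const`; this file is their (0.4) twin.  The one new ingredient is §1: the SYMMETRISED block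
potential `SymLamAt ρ A L y = Σ_{b ∈ box} symAxial A (L•y + ρ) (L•y + b)` of a form vanishing on every bond interior to an `L`-block is `0` — every permuted comb between two points
of one block reads only intra-block bonds (GAN24 `SymFaceDataVHNull.symAxial_eq_zero_of_faceForm`, fed the blk-form ⟹ mod-form bridge `PiBmConstants.blk_add_unitVec_apply`) — so
`ζ_S = (d!)⁻¹ SymLamAt = 0` and the (0.4) mean `avSym = contourSum − dz ζ_S∕…` (`symLinAvgAt_eq_contourSum_sub_dz`) of such a form is the straight contour sum, which PART 50
`contourSum_eq_zero_of_faceSupported` kills off the coarse faces; the induction of PART 50 §3 then runs verbatim on `compLinAvgSymAt ∕ compDefectSymAt` (an2 gen-89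
`CompositeAveragingCoarseExactGeneric`), and `Ψˢ_m = 1 + |box|⁻¹ dz ∘ ext ∘ ζˢ_m` (`corrPsiSym_eq`) fixes the form.  §3 is PART 51 §1∕§3 over F-L7b
`NVertexColumnK1RowSym.colH_ANs_eq_corrPsiSym_colH_coDress` and the generic finite expansion `CompositeCorrectorKernel.apply_eq_sum_of_depOn` fed PART 127∕128
`depOn_corrPsiSym ∕ corrPsiSym_sum_smul`.

WHAT ([folklore] finite-sum ∕ integer bookkeeping BY NAME; no `def`, no `def … : Prop`, nothing cited, 0 sorry):
§1 `blk_add_unitVec_eq_of_mod_ne`, `faceForm_of_faceSupported`, **`SymLamAt_eq_zero_of_faceSupported`**, **`zetaS_eq_zero_of_faceSupported`**, **`avSym_faceSupported_descends`**;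
§2 **`compLinAvgSymAt_faceSupported`**, **`compDefectSymAt_eq_zero_of_faceSupported`**, **`corrPsiSym_eq_self_of_faceSupported`**, `corrPhiSym_eq_self_of_faceSupported`,
**`corrPsiSym_axProjBmAt_const`** (`Ψˢ_m (Π^ρ_bm (κ ↦ c κ)) = Π^ρ_bm (κ ↦ c κ)` at `N = L^m`);
§3 **`ANs_inl_inr_smul_eq_corrPsiSym_axProjBmAt`** (`ANs R Ψ̂ˢ j x (L•z) (inl α) (inr μ) = (Ψˢ_{j+1} (Π^{s_{j+1}}_bm (ℋ_μ(· − L•z))))_α(x)`), `hasSum_corrPsiSym_apply` (a pointwise-convergent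
family pushed through `Ψˢ_m` at one output bond), **`hasSum_ANs_inl_inr_sources`** (U1 at the L-chart's kernel letter: `HasSum (z ↦ ANs … x (L•z) (inl α) (inr μ)) ((Π_bm (κ ↦ δ_{κμ} L^{−(d+2)}))_α(x))`),
**`tsum_ANs_inl_inr_sources_eq`** (the face read-out: `L·δ_{αμ}·L^{−(d+2)}` on the `μ`-bonds crossing an `L`-face, `0` elsewhere, whatever the roots).
WHAT THIS IS NOT: not `hΘ` at the L door yet (the σ-conjugated lattice-sum ∕ `ℓ^∞` packaging over PART 84∕86 is the next file `TowerDoorGaugeRecordS`); not `hlawL`, not S-L3b's crux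
`d1Tel_L_of_hlawL'`, not any of v10's 118 displayed rows; nothing of Bałaban's asserted, valued or discharged; 0 estimates; 0∕4 row-D1 binders (hW, hR, D1Tel, D1Rep); NOT (C1), NOT (T-ID),
NOT D1, NEVER «G-an2-4 closed», NOT BetaPertH, NOT continuum, NOT Clay.

HONEST DEPENDENCY (page 1, mandatory): continuum YM on T⁴ ⇐ BetaPertH ∧ nine spine estimates (0/9 proved); BetaPertH ⇐ (D1) ∧ (D4) ∧ CAP+tail;
G-an2-4 gates asym, D1 and NE2/3/4.  HONEST FRAMING (cell contract, verbatim): «discharging `BetaPertH` makes Bałaban's UV stability UNCONDITIONAL —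
a real constructive-QFT result; it is NOT the continuum limit and NOT the Clay problem.»  ABSOLUTE RULE (cell charter, verbatim): «No internally-minted
statement may enter as a cited fact. Every hypothesis is either kernel-proved in this package or a verbatim quotation of a PUBLISHED theorem with page
reference. The manuscript(s) under audit are NOT citable for their own disputed steps — they are the thing under adjudication; programme-internal
(2001/route/tribunal) claims are never citable.»  Row D1 ∕ (C1) OWNER «beta-an2» gen 94, 2026-08-31.  No existing file touched.
-/

noncomputable section

open Finset
open scoped BigOperators Nat
open Literature.MathematicalPhysics.QuantumFieldTheory
open Literature.MathematicalPhysics.QuantumFieldTheory.Balaban1983to89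
open Literature.MathematicalPhysics.QuantumFieldTheory.Balaban1983to89.Beta
open AffineAveraging (Form0 Form1 Site box toSite unitVec unitVec_apply dz blockSum contourSum)
open AveragingContours (blk)
open OneStepResolventKernel (Fib KInv)
open OneStepKernelFamily (colH)
open ResolventComposition (Hcol)
open Summit.QuantumFields.BalabanUV.Beta.SymmetrisedAxialPotential (symAxial SymLamAt symLinAvgAt symLinAvgAt_eq_contourSum_sub_dz)
open Summit.QuantumFields.BalabanUV.Beta.SymCorrectorForms (zetaS zetaS_apply)
open Summit.QuantumFields.BalabanUV.Beta.CompositeAveragingCoarseExactGeneric (avSym avSym_apply compLinAvgSymAt compDefectSymAt compLinAvgSymAt_zero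
  compLinAvgSymAt_succ compDefectSymAt_zero compDefectSymAt_succ corrPsiSym corrPhiSym corrPsiSym_eq corrPhiSym_eq corrPsiSym_sum_smul depOn_corrPsiSym)
open Summit.QuantumFields.BalabanUV.Beta.CompositeCorrectorForms (ext blockSum_zero blk_blk)
open Summit.QuantumFields.BalabanUV.Beta.CompositeCorrectorKernel (indR exists_finset_corrReads apply_eq_sum_of_depOn)
open Summit.QuantumFields.BalabanUV.Beta.FP.TowerDoorUniformDataCorrector (contourSum_eq_zero_of_faceSupported dz_ext_zero)
open Summit.QuantumFields.BalabanUV.Beta.GAN24.SymFaceDataVHNull (symAxial_eq_zero_of_faceForm)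
open Summit.QuantumFields.BalabanUV.Beta.GAN24.PiBmConstants (axProjBmAt_const_apply blk_add_unitVec_apply)
open Summit.QuantumFields.BalabanUV.Beta.AxialProjectorBlockMean (axProjBmAt)
open Summit.QuantumFields.BalabanUV.Beta.AxialDressingRooted (coProjBmW coDressKBmAt one_le_of_neZero)
open Summit.QuantumFields.BalabanUV.Beta.GAN24.AxProjBmWindow (colH_coDressKBmAt_eq_axProjBmAt axProjBmAt_eq_coProjBmW')
open Summit.QuantumFields.BalabanUV.Beta.BlockMeanChartK1Row (colH_KInv_eq_Hcol)
open Summit.QuantumFields.BalabanUV.Beta.CompositeOneShotJetData (Roots)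
open Summit.QuantumFields.BalabanUV.Beta.CompositeCorrectorKernelSym (psiKSym)
open Summit.QuantumFields.BalabanUV.Beta.FP.CompositeOneShotJetDataSym (ANs)
open Summit.QuantumFields.BalabanUV.Beta.NVertexColumnK1RowSym (colH_ANs_eq_corrPsiSym_colH_coDress colH_ANs_eq_corrPsiSym_coProjBmW_Hcol)
open Summit.QuantumFields.BalabanUV.Beta.FP.TowerDoorUniformDataColumn (hasSum_coProjBmW_apply hasSum_Hcol_translate)

namespace Summit.QuantumFields.BalabanUV.Beta.FP.TowerDoorUniformDataSym

variable {d : ℕ}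

/-! ## §1 The symmetrised block potential of a face-supported form vanishes; one (0.4) averaging step lowers the face scale -/

section Form

/-- [folklore] a bond that does not cross an `L`-face stays in its `L`-block (`PiBmConstants.blk_add_unitVec_apply`). -/
theorem blk_add_unitVec_eq_of_mod_ne {L : ℕ} (hL : 1 ≤ L) (x : Site (d + 1)) (κ : Fin (d + 1))
    (h : x κ % (L : ℤ) ≠ (L : ℤ) - 1) : blk L (x + unitVec κ) = blk L x := by
  funext i
  rw [blk_add_unitVec_apply hL x κ i, if_neg (fun hc => h hc.2), add_zero]

/-- [folklore] FACE-SUPPORTED (blk form: `blk L (z + e_κ) = blk L z ⟹ A κ z = 0`) ⟹ FACE FORM (mod form: `x_κ % L ≠ L − 1 ⟹ A κ x = 0`, GAN24's hypothesis shape). -/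
theorem faceForm_of_faceSupported {L : ℕ} (hL : 1 ≤ L) {A : Form1 (d + 1) ℝ}
    (hA : ∀ (κ : Fin (d + 1)) (z : Site (d + 1)), blk L (z + unitVec κ) = blk L z → A κ z = 0) :
    ∀ (κ : Fin (d + 1)) (x : Fin (d + 1) → ℤ), x κ % (L : ℤ) ≠ (L : ℤ) - 1 → A κ x = 0 :=
  fun κ x hx => hA κ x (blk_add_unitVec_eq_of_mod_ne hL x κ hx)

/-- [folklore] **`SymLamAt_eq_zero_of_faceSupported` — THE SYMMETRISED BLOCK POTENTIAL OF A FACE-SUPPORTED FORM VANISHES** (in-block root): every permuted comb between two points of one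
`L`-block reads only intra-block bonds (GAN24 `symAxial_eq_zero_of_faceForm`). -/
theorem SymLamAt_eq_zero_of_faceSupported {L : ℕ} (hL : 1 ≤ L) {r : Fin (d + 1) → ℕ} (hr : r ∈ box (d + 1) L) {A : Form1 (d + 1) ℝ}
    (hA : ∀ (κ : Fin (d + 1)) (z : Site (d + 1)), blk L (z + unitVec κ) = blk L z → A κ z = 0) (y : Site (d + 1)) :
    SymLamAt (toSite r) A L y = 0 := by
  unfold SymmetrisedAxialPotential.SymLamAt
  exact Finset.sum_eq_zero fun b hb => symAxial_eq_zero_of_faceForm (faceForm_of_faceSupported hL hA) y hr hb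

/-- [folklore] **`zetaS_eq_zero_of_faceSupported`** — hence the (0.4) one-step defect potential `ζ_S = (d!)⁻¹ • SymLamAt` of such a form is `0`. -/
theorem zetaS_eq_zero_of_faceSupported {L : ℕ} (hL : 1 ≤ L) {r : Fin (d + 1) → ℕ} (hr : r ∈ box (d + 1) L) {A : Form1 (d + 1) ℝ}
    (hA : ∀ (κ : Fin (d + 1)) (z : Site (d + 1)), blk L (z + unitVec κ) = blk L z → A κ z = 0) :
    zetaS (toSite r) L A = 0 := by
  funext y
  rw [Pi.zero_apply, zetaS_apply, SymLamAt_eq_zero_of_faceSupported hL hr hA y, mul_zero]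

/-- [folklore] **`avSym_faceSupported_descends` — ONE (0.4) AVERAGING STEP LOWERS THE FACE SCALE**: if `A` is face-supported at scale `L^(n+1)`, the (0.4) mean `avSym ρs L k A`
(in-block roots) vanishes at every coarse bond interior to an `L^n`-block of the coarse lattice — the mean is `contourSum − (d!)⁻¹ dz SymLamAt` (`symLinAvgAt_eq_contourSum_sub_dz`),
the potential is `0` (§1, `A` being face-supported at scale `L` a fortiori) and the straight contour sum vanishes there (PART 50 `contourSum_eq_zero_of_faceSupported`). -/
theorem avSym_faceSupported_descends {L : ℕ} (hL : 1 ≤ L) {r : ℕ → (Fin (d + 1) → ℕ)} (hr : ∀ k, r k ∈ box (d + 1) L) (k n : ℕ) {A : Form1 (d + 1) ℝ}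
    (hA : ∀ (κ : Fin (d + 1)) (z : Site (d + 1)), blk (L ^ (n + 1)) (z + unitVec κ) = blk (L ^ (n + 1)) z → A κ z = 0)
    (μ : Fin (d + 1)) (y : Site (d + 1)) (hy : blk (L ^ n) (y + unitVec μ) = blk (L ^ n) y) :
    avSym (fun k => toSite (r k)) L k A μ y = 0 := by
  -- face-supported at scale `L^(n+1)` ⟹ face-supported at scale `L`
  have hA1 : ∀ (κ : Fin (d + 1)) (z : Site (d + 1)), blk L (z + unitVec κ) = blk L z → A κ z = 0 := by
    intro κ z hz
    apply hA κ z
    have hw : ∀ w : Site (d + 1), blk (L ^ (n + 1)) w = blk (L ^ n) (blk L w) := fun w => blk_blk (by omega) n w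
    rw [hw, hw, hz]
  have hS : ∀ y' : Site (d + 1), SymLamAt (toSite (r k)) A L y' = 0 := fun y' => SymLamAt_eq_zero_of_faceSupported hL (hr k) hA1 y'
  rw [avSym_apply, symLinAvgAt_eq_contourSum_sub_dz, contourSum_eq_zero_of_faceSupported hL n hA μ y hy]
  simp only [AffineAveraging.dz, hS, sub_self, mul_zero]

end Form

/-! ## §2 The composite (0.4) averaging and its defect potential on face-supported forms; the corrector fixes them; the uniform-data instance -/

section Composite

variable {L : ℕ} (hL : 1 ≤ L) (r : ℕ → (Fin (d + 1) → ℕ)) (hr : ∀ k, r k ∈ box (d + 1) L)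
include hL hr

/-- [folklore] **`compLinAvgSymAt_faceSupported`**: for `A` face-supported at scale `L^m` and `k ≤ m`, the `k`-fold composite (0.4) average `𝒜ˢ_k A` is face-supported at scale `L^(m−k)`. -/
theorem compLinAvgSymAt_faceSupported (m : ℕ) {A : Form1 (d + 1) ℝ}
    (hA : ∀ (κ : Fin (d + 1)) (z : Site (d + 1)), blk (L ^ m) (z + unitVec κ) = blk (L ^ m) z → A κ z = 0) :
    ∀ k, k ≤ m → ∀ (κ : Fin (d + 1)) (z : Site (d + 1)), blk (L ^ (m - k)) (z + unitVec κ) = blk (L ^ (m - k)) z →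
      compLinAvgSymAt (fun k => toSite (r k)) L k A κ z = 0 := by
  intro k
  induction k with
  | zero => intro _ κ z hz; rw [compLinAvgSymAt_zero]; exact hA κ z (by simpa using hz)
  | succ k ih =>
    intro hk κ z hz
    rw [compLinAvgSymAt_succ]
    have hk' : k ≤ m := by omega
    have e : m - k = (m - (k + 1)) + 1 := by omega
    have ih' : ∀ (κ : Fin (d + 1)) (z : Site (d + 1)), blk (L ^ ((m - (k + 1)) + 1)) (z + unitVec κ) = blk (L ^ ((m - (k + 1)) + 1)) z →
        compLinAvgSymAt (fun k => toSite (r k)) L k A κ z = 0 := by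
      intro κ' z' hz'; exact ih hk' κ' z' (by rw [e]; exact hz')
    exact avSym_faceSupported_descends hL hr k (m - (k + 1)) ih' κ z hz

/-- [folklore] **`compDefectSymAt_eq_zero_of_faceSupported` — THE (0.4) DEFECT POTENTIAL OF A FACE-SUPPORTED FORM VANISHES AT EVERY DEPTH `k ≤ m`**: each stage's `ζ_S` is taken at scale `L`
of a form face-supported at scale `L^(m−k) ≥ L` (§1), and block sums of `0` are `0`. -/
theorem compDefectSymAt_eq_zero_of_faceSupported (m : ℕ) {A : Form1 (d + 1) ℝ}
    (hA : ∀ (κ : Fin (d + 1)) (z : Site (d + 1)), blk (L ^ m) (z + unitVec κ) = blk (L ^ m) z → A κ z = 0) :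
    ∀ k, k ≤ m → compDefectSymAt (fun k => toSite (r k)) L k A = 0 := by
  intro k
  induction k with
  | zero => intro _; exact compDefectSymAt_zero _ L A
  | succ k ih =>
    intro hk
    rw [compDefectSymAt_succ, ih (by omega), blockSum_zero, zero_add]
    -- the stage-`k` average is face-supported at scale `L^(m−k)` with `m − k ≥ 1`, hence at scale `L`; its `ζ_S` vanishes
    have hface : ∀ (κ : Fin (d + 1)) (z : Site (d + 1)), blk L (z + unitVec κ) = blk L z → compLinAvgSymAt (fun k => toSite (r k)) L k A κ z = 0 := by
      intro κ z hz
      apply compLinAvgSymAt_faceSupported hL r hr m hA k (by omega) κ z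
      have e : m - k = (m - k - 1) + 1 := by omega
      have hw : ∀ w : Site (d + 1), blk (L ^ (m - k)) w = blk (L ^ (m - k - 1)) (blk L w) := fun w => by
        rw [e]; exact blk_blk (by omega) (m - k - 1) w
      rw [hw, hw, hz]
    exact zetaS_eq_zero_of_faceSupported hL (hr k) hface

/-- [folklore] **`corrPsiSym_eq_self_of_faceSupported` — `Ψˢ_m` FIXES EVERY FORM FACE-SUPPORTED AT SCALE `L^m`** (its defect potential vanishes). -/
theorem corrPsiSym_eq_self_of_faceSupported (m : ℕ) {A : Form1 (d + 1) ℝ}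
    (hA : ∀ (κ : Fin (d + 1)) (z : Site (d + 1)), blk (L ^ m) (z + unitVec κ) = blk (L ^ m) z → A κ z = 0) :
    corrPsiSym r L m A = A := by
  rw [corrPsiSym_eq, compDefectSymAt_eq_zero_of_faceSupported hL r hr m hA m le_rfl, dz_ext_zero, smul_zero, add_zero]

/-- [folklore] … and so does its inverse `Φˢ_m`. -/
theorem corrPhiSym_eq_self_of_faceSupported (m : ℕ) {A : Form1 (d + 1) ℝ}
    (hA : ∀ (κ : Fin (d + 1)) (z : Site (d + 1)), blk (L ^ m) (z + unitVec κ) = blk (L ^ m) z → A κ z = 0) :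
    corrPhiSym r L m A = A := by
  rw [corrPhiSym_eq, compDefectSymAt_eq_zero_of_faceSupported hL r hr m hA m le_rfl, dz_ext_zero, smul_zero, sub_zero]

/-- [folklore] **`corrPsiSym_axProjBmAt_const` — THE UNIFORM-DATA INSTANCE AT THE TREE's LETTER**: for every root offset `ρ` and constants `c`, `Ψˢ_m (Π^ρ_bm (κ ↦ c κ)) = Π^ρ_bm (κ ↦ c κ)`
at `N = L^m` (`PiBmConstants.axProjBmAt_const_apply`: the form lives on the bonds with `x_κ % N = N − 1`, which leave their block by `blk_add_unitVec_apply`). -/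
theorem corrPsiSym_axProjBmAt_const (m : ℕ) (ρ : Fin (d + 1) → ℤ) (c : Fin (d + 1) → ℝ) :
    corrPsiSym r L m (axProjBmAt ρ (L ^ m) (fun κ _ => c κ)) = axProjBmAt ρ (L ^ m) (fun κ _ => c κ) := by
  have hLm : 1 ≤ L ^ m := Nat.one_le_pow _ _ (by omega)
  refine corrPsiSym_eq_self_of_faceSupported hL r hr m fun κ z hz => ?_
  rw [axProjBmAt_const_apply ρ hLm c κ z, if_neg]
  intro hf
  have e := congrFun hz κ
  rw [blk_add_unitVec_apply hLm z κ κ, if_pos ⟨rfl, hf⟩] at e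
  omega

end Composite

/-! ## §3 The L-chart's field–multiplier column is `Ψ̂ˢ (Π_bm (ℋ-column))`; U1 at the kernel letter; the face read-out -/

section Push

variable {d' : ℕ}

/-- [folklore] **PUSHING A POINTWISE-CONVERGENT FAMILY THROUGH `Ψˢ_m` AT ONE OUTPUT BOND**: `Ψˢ_m`'s component reads finitely many bonds linearly (generic `apply_eq_sum_of_depOn` fed
PART 127∕128 `depOn_corrPsiSym ∕ corrPsiSym_sum_smul`). -/
theorem hasSum_corrPsiSym_apply {L : ℕ} (hL : 0 < L) {r : ℕ → (Fin (d' + 1) → ℕ)} (hr : ∀ k, r k ∈ box (d' + 1) L) (m : ℕ)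
    {ι : Type*} {A : ι → Form1 (d' + 1) ℝ} {Ainf : Form1 (d' + 1) ℝ} (hA : ∀ κ y, HasSum (fun i => A i κ y) (Ainf κ y))
    (α : Fin (d' + 1)) (x : Site (d' + 1)) :
    HasSum (fun i => corrPsiSym r L m (A i) α x) (corrPsiSym r L m Ainf α x) := by
  obtain ⟨S, hS⟩ := exists_finset_corrReads hL m α x
  have e : ∀ B : Form1 (d' + 1) ℝ, corrPsiSym r L m B α x = ∑ p ∈ S, corrPsiSym r L m (indR p.1 p.2) α x * B p.1 p.2 :=
    fun B => apply_eq_sum_of_depOn (depOn_corrPsiSym hL hr m α x) hS (fun s c B' => corrPsiSym_sum_smul (r := r) (L := L) m s c B') B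
  rw [show (fun i => corrPsiSym r L m (A i) α x) = fun i => ∑ p ∈ S, corrPsiSym r L m (indR p.1 p.2) α x * A i p.1 p.2 from
    funext fun i => e (A i), e Ainf]
  exact hasSum_sum fun p _ => (hA p.1 p.2).mul_left _

end Push

section Uniform

variable {Lc : ℕ} [NeZero Lc] (R : Roots Lc) (j : ℕ)

/-- [folklore] **`ANs_inl_inr_smul_eq_corrPsiSym_axProjBmAt` — THE KERNEL JUNCTION AT THE (0.4) CHART**: for every root data `R`, door index `j` (`L = Lc^(j+1)`), fine bond `(α, x)` and
coarse source `(μ, z)`, `ANs R Ψ̂ˢ j x (L•z) (inl α) (inr μ) = (Ψˢ_{j+1} (Π^{s_{j+1}}_bm (ℋ_μ(· − L•z))))_α(x)` (F-L7b `colH_ANs_eq_corrPsiSym_colH_coDress`; GAN24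
`colH_coDressKBmAt_eq_axProjBmAt`; `colH_KInv_eq_Hcol`). -/
theorem ANs_inl_inr_smul_eq_corrPsiSym_axProjBmAt (x z : Site (3 + 1)) (α μ : Fin (3 + 1)) :
    ANs R (fun m => psiKSym R.rc Lc m) j x (((Lc ^ (j + 1) : ℕ) : ℤ) • z) (Sum.inl α) (Sum.inr μ)
      = corrPsiSym R.rc Lc (j + 1) (axProjBmAt (toSite (R.s (j + 1))) (Lc ^ (j + 1)) (Hcol (N := Lc ^ (j + 1)) μ z)) α x := by
  have h := colH_ANs_eq_corrPsiSym_colH_coDress R j μ z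
  have h2 := colH_coDressKBmAt_eq_axProjBmAt (one_le_of_neZero (Lc ^ (j + 1))) (R.hs (j + 1)) (KInv (N := Lc ^ (j + 1)) (d := 3)) μ z
  rw [colH_KInv_eq_Hcol] at h2
  rw [h2] at h
  exact congrFun (congrFun h α) x

/-- [folklore] **`hasSum_ANs_inl_inr_sources` — U1 AT THE L-CHART's KERNEL LETTER: THE (0.4) ONE-SHOT CHART's RESPONSE TO UNIFORM DATA IS THE COMB REPRESENTATIVE OF THE CONSTANT CONNECTION.**
`HasSum (z ↦ ANs R Ψ̂ˢ j x (L•z) (inl α) (inr μ)) ((Π^{s_{j+1}}_bm (κ ↦ δ_{κμ}·L^{−(d+2)}))_α(x))`, `L = Lc^(j+1)` (F-L7b at every source; PART 51's two pushes over lit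
`lowMomentsSum_specK`; then §2 `corrPsiSym_axProjBmAt_const` removes `Ψ̂ˢ`). -/
theorem hasSum_ANs_inl_inr_sources (x : Site (3 + 1)) (α μ : Fin (3 + 1)) :
    HasSum (fun z : Site (3 + 1) => ANs R (fun m => psiKSym R.rc Lc m) j x (((Lc ^ (j + 1) : ℕ) : ℤ) • z) (Sum.inl α) (Sum.inr μ))
      (axProjBmAt (toSite (R.s (j + 1))) (Lc ^ (j + 1)) (fun κ _ => if κ = μ then ((((Lc ^ (j + 1) : ℕ) : ℝ) ^ (3 + 1 + 1))⁻¹) else 0) α x) := by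
  have hL1 : 1 ≤ Lc ^ (j + 1) := one_le_of_neZero (Lc ^ (j + 1))
  have hLc : 0 < Lc := Nat.pos_of_ne_zero (NeZero.ne Lc)
  -- the family, source by source, through `Ψ̂ˢ ∘ Π_bm` of the straight column
  have e : ∀ z : Site (3 + 1), ANs R (fun m => psiKSym R.rc Lc m) j x (((Lc ^ (j + 1) : ℕ) : ℤ) • z) (Sum.inl α) (Sum.inr μ)
      = corrPsiSym R.rc Lc (j + 1) (coProjBmW (toSite (R.s (j + 1))) (Lc ^ (j + 1)) (Hcol (N := Lc ^ (j + 1)) μ z)) α x :=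
    fun z => congrFun (congrFun (colH_ANs_eq_corrPsiSym_coProjBmW_Hcol R j μ z) α) x
  simp_rw [e]
  -- the limit: `Ψ̂ˢ` fixes `Π_bm` of the constant connection (§2), and `Π_bm = coProjBmW`
  rw [← corrPsiSym_axProjBmAt_const hLc R.rc R.hrc (j + 1) (toSite (R.s (j + 1))), axProjBmAt_eq_coProjBmW' hL1 (R.hs (j + 1))]
  exact hasSum_corrPsiSym_apply hLc R.hrc (j + 1)
    (hasSum_coProjBmW_apply (toSite (R.s (j + 1))) (Lc ^ (j + 1)) (fun κ w => hasSum_Hcol_translate (Lc ^ (j + 1)) μ κ w)) α x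

/-- [folklore] **`tsum_ANs_inl_inr_sources_eq` — THE FACE READ-OUT AT THE (0.4) CHART**: `Σ'_z ANs R Ψ̂ˢ j x (L•z) (inl α) (inr μ) = if x_α % L = L − 1 then L·(δ_{αμ}·L^{−(d+2)}) else 0`,
WHATEVER THE ROOTS (tree `PiBmConstants.axProjBmAt_const_apply`). -/
theorem tsum_ANs_inl_inr_sources_eq (x : Site (3 + 1)) (α μ : Fin (3 + 1)) :
    (∑' z : Site (3 + 1), ANs R (fun m => psiKSym R.rc Lc m) j x (((Lc ^ (j + 1) : ℕ) : ℤ) • z) (Sum.inl α) (Sum.inr μ))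
      = if x α % ((Lc ^ (j + 1) : ℕ) : ℤ) = ((Lc ^ (j + 1) : ℕ) : ℤ) - 1
        then ((Lc ^ (j + 1) : ℕ) : ℝ) * (if α = μ then ((((Lc ^ (j + 1) : ℕ) : ℝ) ^ (3 + 1 + 1))⁻¹) else 0) else 0 := by
  rw [(hasSum_ANs_inl_inr_sources R j x α μ).tsum_eq, axProjBmAt_const_apply _ (one_le_of_neZero (Lc ^ (j + 1)))]

end Uniform

end Summit.QuantumFields.BalabanUV.Beta.FP.TowerDoorUniformDataSym

end
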